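import Summits.ABC.ABC.Theorems.SomeWindowSaving.Negative.WindowFinite
import Literature.NumberTheory.DiophantineGeometry.XYZConjectureABCExponent

/-!
# Crux `TwistAmplification.ModerateWindowCount` (stmt-ABC-1973) — ideator 3 sketch (round 1)

Planner scratch file of `planner-cruxidea-stmt-ABC-1973-3-0` (crux-ideate, round 1, ideator 3).
Everything here is over existing declarations; the proofs are short real arithmetic and are
COMPLETE (no `sorry`) except where marked as an open statement (`def … : Prop`).

Contents
* §0 `moderateWindowCount_iff` — the crux is literally the statement about
  `windowCount κ σ X` of `Theorems/SomeWindowSaving/Negative/Defs.lean` (same set-builder), `Iff.rfl`.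
* §1 CALIBRATION (the inert box at `κ ∈ (6,σ)`):
  `CofiniteGenSzpiroAll` (cofinite generalized Szpiro for EVERY exponent `s > 6`) ⟹ the crux
  (`moderateWindowCount_of_cofiniteGenSzpiroAll`, witness `κ := (σ+6)/2`, `δ := 0`), and conversely the
  crux ⟹ `CofiniteGenSzpiroAll` given the route's two supports `QuadraticTwistInvariants` (stmt-ABC-1977) and
  `TwistAmplificationLemma` (stmt-ABC-1978) (`cofiniteGenSzpiroAll_of_moderateWindowCount`). So, modulo the
  supports, the crux IS generalized Szpiro with every exponent `> 6` (abc strength, Bombieri–Gubler 12.5.12).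
* §2 THE LEVER OF THE IDEA CARD `exceptional-set-by-conductor`: put the lower edge ON the Szpiro line,
  `κ := 6`, which only this crux allows (`3 < κ < σ`). Two sufficient statements, each with a one-line glue:
  `ExcessLaw` (per excess `v = σ − 6`: `T⁺_[6,6+v](X) ≤ C·X^δ`, some `δ < v/(6+2v)`) and the uniform
  `ExceptionalSetSubpolynomial` (`T⁺_[6,σ](X) ≤ C_{σ,ε} X^ε` for every `σ > 6`, `ε > 0` — the
  conductor-ordered Fouvry–Nair–Tenenbaum exceptional-set estimate with exponent `0`).
* §3 `twistFibre_short` — above the line twist fibres are SHORT: if the twist `E₀^d` (ratio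
  `(β₀ n + 6t)/(n + 2t)`, `n = log N₀`, `t = log d`) still has ratio `≥ 6` then `6 t ≤ (β₀ − 6) n`, i.e.
  `d ≤ N₀^{(β₀−6)/6}` (real arithmetic only).
* §4 THE FREY-SLICE SANDWICH AT `κ = 6` (statements only, typed; proofs are paper, see the card D7):
  `FreyTwistExcess σ δ` (the `κ = 6` window bound for Frey–twist data, same predicate as the route's
  `FreyAmplification` hypothesis), `FreySandwichOfABC` (`ABC → MazurKaneLaw → ∀ σ>6, ∃ δ < (σ−6)/(2σ−6), FreyTwistExcess σ δ`)
  and `FreySandwichOfWeakABC` (`ABCExponentBound κ₁ → MazurKaneLaw → FreyTwistExcess σ δ` for `σ` large in terms of `κ₁`).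
* §5 `norm_num` checks of the Mersenne-triple arithmetic quoted in the card's census (k = 5, 6, 12).
-/

noncomputable section

set_option linter.dupNamespace false

open IsDedekindDomain WeierstrassCurve
open Summit.ABC.ABC.Theses.TwistAmplification
  (ModerateWindowCount QuadraticTwistInvariants TwistAmplificationLemma)
open Summit.ABC.ABC.Theorems.SomeWindowSaving.Negative (windowSet windowCount windowSet_finite)

namespace Summit.ABC.ABC.Cruxes.ModerateWindowCount.SketchIdeator3

/-! ## §0 The crux through `windowCount` -/

/-- The crux is literally the window-count statement (same set-builder as `windowSet`). -/
theorem moderateWindowCount_iff :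
    ModerateWindowCount ↔ ∀ σ : ℝ, 6 < σ → ∃ κ δ C : ℝ, 3 < κ ∧ κ < σ ∧ δ < (σ - κ) / (2 * σ - 6) ∧
      ∀ X : ℝ, 1 ≤ X → (windowCount κ σ X : ℝ) ≤ C * X ^ δ :=
  Iff.rfl

/-! ## §1 Calibration: the inert box at `κ ∈ (6, σ)` -/

/-- COFINITE GENERALIZED SZPIRO FOR EVERY EXPONENT `s > 6`: for each `s > 6` some `N₀` beyond which every
integral model minimal at all places, elliptic over `ℚ`, with `c₄ c₆ ≠ 0`, has `max(|Δ|,|c₄|³) ≤ N^s`.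
Abc strength (Bombieri–Gubler Conj. 12.5.11 / Thm. 12.5.12); OPEN. -/
def CofiniteGenSzpiroAll : Prop :=
  ∀ s : ℝ, 6 < s → ∃ N₀ : ℝ, ∀ W₀ : WeierstrassCurve ℤ, (W₀.baseChange ℚ).IsElliptic →
    (∀ v : HeightOneSpectrum ℤ, (W₀.baseChange ℚ).IsMinimalAt v) → W₀.c₄ ≠ 0 → W₀.c₆ ≠ 0 →
      N₀ ≤ (((W₀.baseChange ℚ).conductorNorm ℤ : ℕ) : ℝ) →
        ((max |W₀.Δ| (|W₀.c₄| ^ 3) : ℤ) : ℝ) ≤ (((W₀.baseChange ℚ).conductorNorm ℤ : ℕ) : ℝ) ^ s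

/-- Window confinement: under a cofinite bound with exponent `s` beyond `N₀`, a window whose LOWER edge
`κ` exceeds `s` contains only curves of conductor `< max N₀ 2`. -/
theorem windowSet_subset_of_cofinite {s κ σ N₀ : ℝ} (hsκ : s < κ)
    (h : ∀ W₀ : WeierstrassCurve ℤ, (W₀.baseChange ℚ).IsElliptic →
      (∀ v : HeightOneSpectrum ℤ, (W₀.baseChange ℚ).IsMinimalAt v) → W₀.c₄ ≠ 0 → W₀.c₆ ≠ 0 →
        N₀ ≤ (((W₀.baseChange ℚ).conductorNorm ℤ : ℕ) : ℝ) →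
          ((max |W₀.Δ| (|W₀.c₄| ^ 3) : ℤ) : ℝ) ≤ (((W₀.baseChange ℚ).conductorNorm ℤ : ℕ) : ℝ) ^ s)
    (X : ℝ) : windowSet κ σ X ⊆ windowSet κ σ (max N₀ 2) := by
  intro W hW
  obtain ⟨hE, hmin, ha₁, ha₃, ha₂, hc₄, hc₆, -, hlo, hhi⟩ := hW
  refine ⟨hE, hmin, ha₁, ha₃, ha₂, hc₄, hc₆, ?_, hlo, hhi⟩
  set n : ℝ := (((W.baseChange ℚ).conductorNorm ℤ : ℕ) : ℝ) with hn
  by_contra hlt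
  rw [not_le] at hlt
  have hN₀ : N₀ ≤ n := le_trans (le_max_left _ _) hlt.le
  have hn2 : (2 : ℝ) ≤ n := le_trans (le_max_right _ _) hlt.le
  have hn1 : (1 : ℝ) < n := by linarith
  have hM := h W hE hmin hc₄ hc₆ hN₀
  have h1 : n ^ κ ≤ n ^ s := le_trans hlo hM
  have h2 : n ^ s < n ^ κ := Real.rpow_lt_rpow_of_exponent_lt hn1 hsκ
  linarith

/-- **The inert box at `κ ∈ (6,σ)`.** Cofinite generalized Szpiro for every exponent `> 6` implies the crux,
with NO counting: given `σ > 6` take `κ := (σ+6)/2`, `s := (κ+6)/2 ∈ (6, κ)`, `δ := 0` and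
`C := #windowSet κ σ (max N₀ 2)` (a finite slice, `windowSet_finite`). Unconditional. -/
theorem moderateWindowCount_of_cofiniteGenSzpiroAll (h : CofiniteGenSzpiroAll) : ModerateWindowCount := by
  intro σ hσ
  set κ : ℝ := (σ + 6) / 2 with hκ
  have hκ6 : 6 < κ := by rw [hκ]; linarith
  have hκσ : κ < σ := by rw [hκ]; linarith
  obtain ⟨N₀, hN₀⟩ := h ((κ + 6) / 2) (by linarith)
  refine ⟨κ, 0, ((windowSet κ σ (max N₀ 2)).ncard : ℝ), by linarith, hκσ, ?_, fun X _ ↦ ?_⟩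
  · exact div_pos (by linarith) (by linarith)
  · rw [Real.rpow_zero, mul_one]
    exact_mod_cast Set.ncard_le_ncard
      (windowSet_subset_of_cofinite (by linarith : (κ + 6) / 2 < κ) hN₀ X) (windowSet_finite _ _ _)

/-- **Converse (modulo the route's supports stmt-ABC-1977/1978).** The crux implies cofinite generalized
Szpiro for every exponent `s > 6`: apply the crux at `σ := (s+6)/2 ∈ (6,s)` and amplify to `σ' := s`. -/
theorem cofiniteGenSzpiroAll_of_moderateWindowCount (hTw : QuadraticTwistInvariants)
    (hAmp : TwistAmplificationLemma) (hX : ModerateWindowCount) : CofiniteGenSzpiroAll := by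
  intro s hs
  obtain ⟨κ, δ, C, hκ3, hκσ, hδ, hcount⟩ := hX ((s + 6) / 2) (by linarith)
  exact hAmp hTw κ ((s + 6) / 2) δ C hκ3 hκσ hδ hcount s (by linarith)

/-! ## §2 The lever: count only ABOVE the Szpiro line (`κ := 6`) -/

/-- **ExcessLaw** (per excess `v > 0`): the curves strictly-to-weakly above the Szpiro line with excess
`≤ v` — `N ≤ X`, `N⁶ ≤ max(|Δ|,|c₄|³) ≤ N^{6+v}` — number `≤ C·X^δ` for SOME `δ < v/(6+2v)`
(any saving below the amplification threshold at `κ = 6`; e.g. `δ = v/(7+2v)` would do). OPEN; by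
§1 and amplification it is abc-strength, and it is the minimal-demand sufficient condition of the card. -/
def ExcessLaw : Prop :=
  ∀ v : ℝ, 0 < v → ∃ δ C : ℝ, δ < v / (6 + 2 * v) ∧
    ∀ X : ℝ, 1 ≤ X → (windowCount 6 (6 + v) X : ℝ) ≤ C * X ^ δ

/-- **Glue (one line of real arithmetic): `ExcessLaw → ModerateWindowCount`**, witness `κ := 6`:
at `σ = 6 + v` the threshold `(σ − κ)/(2σ − 6)` IS `v/(6+2v)`. -/
theorem moderateWindowCount_of_excessLaw (h : ExcessLaw) : ModerateWindowCount := by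
  intro σ hσ
  obtain ⟨δ, C, hδ, hC⟩ := h (σ - 6) (by linarith)
  refine ⟨6, δ, C, by norm_num, hσ, ?_, fun X hX ↦ ?_⟩
  · convert hδ using 1
    congr 1 <;> ring
  · have h' := hC X hX
    have e : (6 : ℝ) + (σ - 6) = σ := by ring
    rw [e] at h'
    exact h'

/-- **ExceptionalSetSubpolynomial** (uniform form): for every `σ > 6` and every `ε > 0`,
`T⁺_[6,σ](X) ≤ C_{σ,ε} · X^ε` — the generalized-Szpiro EXCEPTIONAL SET (ratio `≥ 6`), ordered by
CONDUCTOR, has counting exponent `0`. (Fouvry–Nair–Tenenbaum 1992, Thm 1, bound it ordered by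
DISCRIMINANT: `S₀(D;K) ≪ D^{1/K+o(1)}`, which in conductor units is the trivial `X^{1+o(1)}`.) OPEN. -/
def ExceptionalSetSubpolynomial : Prop :=
  ∀ σ ε : ℝ, 6 < σ → 0 < ε → ∃ C : ℝ, ∀ X : ℝ, 1 ≤ X → (windowCount 6 σ X : ℝ) ≤ C * X ^ ε

/-- `ExceptionalSetSubpolynomial → ExcessLaw` (take `ε := v/(7+2v) < v/(6+2v)`). -/
theorem excessLaw_of_exceptionalSetSubpolynomial (h : ExceptionalSetSubpolynomial) : ExcessLaw := by
  intro v hv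
  have hε : 0 < v / (7 + 2 * v) := div_pos hv (by linarith)
  obtain ⟨C, hC⟩ := h (6 + v) (v / (7 + 2 * v)) (by linarith) hε
  refine ⟨v / (7 + 2 * v), C, ?_, hC⟩
  rw [div_lt_div_iff₀ (by linarith) (by linarith)]
  nlinarith

/-- Hence `ExceptionalSetSubpolynomial → ModerateWindowCount`: abc follows from the conductor-ordered
exceptional-set estimate with exponent `0` (through this crux and the route's `closes`). -/
theorem moderateWindowCount_of_exceptionalSetSubpolynomial (h : ExceptionalSetSubpolynomial) :
    ModerateWindowCount :=
  moderateWindowCount_of_excessLaw (excessLaw_of_exceptionalSetSubpolynomial h)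

/-- The per-`σ` budget form actually used: for `σ > 6`, ANY bound `T⁺_[6,σ](X) ≤ C X^δ` with
`δ < (σ − 6)/(2σ − 6)` settles the `σ`-instance of the crux (the budget increases from `0⁺` at `σ → 6⁺` to
`1/2` at `σ → ∞`; at `σ = 7, 8, 12, ∞` it is `1/8, 1/5, 1/3, 1/2`). -/
theorem moderateWindowCount_instance_of_excessBound {σ δ C : ℝ} (hσ : 6 < σ)
    (hδ : δ < (σ - 6) / (2 * σ - 6))
    (hC : ∀ X : ℝ, 1 ≤ X → (windowCount 6 σ X : ℝ) ≤ C * X ^ δ) :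
    ∃ κ δ C : ℝ, 3 < κ ∧ κ < σ ∧ δ < (σ - κ) / (2 * σ - 6) ∧
      ∀ X : ℝ, 1 ≤ X → (windowCount κ σ X : ℝ) ≤ C * X ^ δ :=
  ⟨6, δ, C, by norm_num, hσ, hδ, hC⟩

/-! ## §3 Above the line, twist fibres are short -/

/-- If a curve of ratio `β₀` (log-conductor `n > 0`) twisted by `d` (`t = log d ≥ 0`, conductor `N₀d²`,
size `d⁶M⁺`) still has ratio `(β₀ n + 6 t)/(n + 2 t) ≥ 6`, then `6 t ≤ (β₀ − 6) n`, i.e. `d ≤ N₀^{(β₀−6)/6}`: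
only curves ABOVE the line have twists above the line, and only boundedly short twist fibres. -/
theorem twistFibre_short {β₀ n t : ℝ} (hn : 0 < n) (ht : 0 ≤ t)
    (h : 6 ≤ (β₀ * n + 6 * t) / (n + 2 * t)) : 6 * t ≤ (β₀ - 6) * n := by
  have hpos : 0 < n + 2 * t := by linarith
  rw [le_div_iff₀ hpos] at h
  nlinarith

/-- Conversely every twist with `6 t ≤ (β₀ − 6) n` stays above the line. -/
theorem twistFibre_mem {β₀ n t : ℝ} (hn : 0 < n) (ht : 0 ≤ t)
    (h : 6 * t ≤ (β₀ - 6) * n) : 6 ≤ (β₀ * n + 6 * t) / (n + 2 * t) := by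
  have hpos : 0 < n + 2 * t := by linarith
  rw [le_div_iff₀ hpos]
  nlinarith

/-! ## §4 The Frey-slice sandwich at `κ = 6` (typed statements; OPEN as Lean theorems, proved on paper in the card) -/

open Literature.NumberTheory.DiophantineGeometry (IsABCTriple rad ABCExponentBound)
open Summit.ABC.ABC.Theses.TwistAmplification (MazurKaneLaw)

/-- **FreyTwistExcess σ δ**: the `κ = 6` excess-window bound on FREY–TWIST DATA `t = (a,b,c,d)` (an abc triple and
`d = 1` or a prime `∤ abc`; conductor scale `rad(abc)·d² ≤ X`; window `6·log(rad·d²) ≤ 6·log(cd) ≤ σ·log(rad·d²)`,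
i.e. the predicate of the route's `FreyAmplification` hypothesis at `κ = 6`): every finite set of such data has
`card ≤ C·X^δ`. -/
def FreyTwistExcess (σ δ : ℝ) : Prop :=
  ∃ C : ℝ, ∀ X : ℝ, 1 ≤ X → ∀ S : Finset (ℕ × ℕ × ℕ × ℕ),
    (∀ t ∈ S, IsABCTriple t.1 t.2.1 t.2.2.1 ∧ (t.2.2.2 = 1 ∨ Nat.Prime t.2.2.2) ∧
      Nat.Coprime t.2.2.2 (t.1 * t.2.1 * t.2.2.1) ∧
      ((rad t.1 t.2.1 t.2.2.1 : ℕ) : ℝ) * (t.2.2.2 : ℝ) ^ 2 ≤ X ∧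
      6 * Real.log (((rad t.1 t.2.1 t.2.2.1 : ℕ) : ℝ) * (t.2.2.2 : ℝ) ^ 2) ≤
        6 * Real.log ((t.2.2.1 : ℝ) * (t.2.2.2 : ℝ)) ∧
      6 * Real.log ((t.2.2.1 : ℝ) * (t.2.2.2 : ℝ)) ≤
        σ * Real.log (((rad t.1 t.2.1 t.2.2.1 : ℕ) : ℝ) * (t.2.2.2 : ℝ) ^ 2)) →
    (S.card : ℝ) ≤ C * X ^ δ

/-- **Sandwich, strong form (paper-proved in the card, D7):** abc and the Mazur–Kane law near `s = 1⁺` give the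
Frey-slice excess bound below the `κ = 6` budget for EVERY `σ > 6` (near-hits `c ≤ C_ε r^{1+ε}`, `#near-hits ≤ X^{o(1)}`
by MK, twists `d ≤ min(4c/r, √(X/r))`). The `κ = 6` analogue of support item stmt-ABC-2793. OPEN as a Lean theorem. -/
def FreySandwichOfABC : Prop :=
  _root_.ABC → MazurKaneLaw → ∀ σ : ℝ, 6 < σ → ∃ δ : ℝ, δ < (σ - 6) / (2 * σ - 6) ∧ FreyTwistExcess σ δ

/-- **Sandwich, weak form (paper-proved in the card, D7):** weak abc with exponent `κ₁ ∈ (0,1]`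
(`ABCExponentBound κ₁`, Lagarias–Soundararajan form: `c ≤ C r^{1/κ₁+}` cofinitely) and the Mazur–Kane law near
`s = 1⁺` give `FreyTwistExcess σ δ` with `δ < (σ−6)/(2σ−6)` for every `σ` so large that
`(K−1)/(2K−1) < (σ−6)/(2σ−6)`, `K := 1/κ₁ + 1`. OPEN as a Lean theorem. -/
def FreySandwichOfWeakABC : Prop :=
  ∀ κ₁ : ℝ, 0 < κ₁ → ABCExponentBound κ₁ → MazurKaneLaw →
    ∃ σ₁ : ℝ, ∀ σ : ℝ, σ₁ ≤ σ → ∃ δ : ℝ, δ < (σ - 6) / (2 * σ - 6) ∧ FreyTwistExcess σ δ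

/-! ## §5 Arithmetic behind the at-the-line census (card D3): Mersenne Frey triples `(1, 2^k − 1, 2^k)`

Minimal model `c₄ = a² + ab + b² = 1 + b + b²` (Frey curve after the `u = 2` rescaling), conductor `N = 2·rad(2^k − 1)`
for `k ≥ 5` (semistable arrangement; the conductor value itself is quoted, not recomputed here). -/

/-- `k = 6`: `b = 63`, `rad 63 = 21`, `N = 42`, `c₄ = 4033`, and `c₄³ > N⁶`: generalized ratio `> 6` (≈ 6.66). -/
example : (1 + 63 + 63 ^ 2 : ℤ) = 4033 ∧ (4033 : ℤ) ^ 3 = 65597103937 ∧ (42 : ℤ) ^ 6 = 5489031744 ∧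
    (42 : ℤ) ^ 6 < 4033 ^ 3 := by norm_num

/-- `k = 5`: `b = 31` squarefree, `N = 62`, `c₄ = 993`, and `c₄³ < N⁶`: generalized ratio `< 6` (≈ 5.02). -/
example : (1 + 31 + 31 ^ 2 : ℤ) = 993 ∧ (993 : ℤ) ^ 3 = 979146657 ∧ (62 : ℤ) ^ 6 = 56800235584 ∧
    (993 : ℤ) ^ 3 < 62 ^ 6 := by norm_num

/-- `k = 12`: `b = 4095 = 3²·5·7·13`, `rad b = 1365`, `N = 2730`, `c₄ = 1 + b + b² = 16773121`, `c₄³ > N⁶` (ratio ≈ 6.31). -/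
example : (1 + 4095 + 4095 ^ 2 : ℤ) = 16773121 ∧ (2730 : ℤ) ^ 6 < 16773121 ^ 3 := by norm_num

end Summit.ABC.ABC.Cruxes.ModerateWindowCount.SketchIdeator3
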